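import Mathlib
import Summits.AtomisticToContinuum.HydrodynamicLimit.Theorems.OneSphereInfluenceStaticScoreResponseKPLog
import Summits.AtomisticToContinuum.HydrodynamicLimit.Theorems.OneSphereInfluenceStaticScoreResponsePolymerRep
import Summits.AtomisticToContinuum.HydrodynamicLimit.Theorems.OneSphereInfluenceStaticScoreResponseTiltedActivityReal
import Literature.MathematicalPhysics.KineticTheory.HardSphereEulerRatio
import Literature.Probability.LatticeModels.ClusterExpansionKPBound
import HarnessLib

/-!
# `StaticScoreResponse` (support item stmt-AtomisticToContinuum-12269): Kotecký–Preiss smallness of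
# the tilted polymer gas and the holomorphic logarithm of the tilted hard-core probability

For the canonical hard-core gas of `n = |ι|` independent points with common law `ν`, overlap
relation `O` whose balls have `ν`-mass `≤ p`, and a one-body observable `|G| ≤ 1`, the subset polymer
gas with the complex-tilted activities `ζ_s(B)` (`TiltedActivity*`) satisfies the finite-volume
Kotecký–Preiss condition with size function `a(B) = |B|` as soon as `2A²e⁴ · n p ≤ 1`
(`A = 2e^{1/4}`), uniformly in the tilt `‖s‖ ≤ 1/4` (`isKPVolume_tilted`): the polymers through a
label carry total weight `∑_{B ∋ i} ‖ζ_s(B)‖ e^{|B|} ≤ 2A²e⁴ n p` (`sum_kpTerm_filter_mem_le`; tree bound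
`t(j+1) yʲ/j! ≤ e (ey)ʲ` and `C(m, j) ≤ mʲ/j!`).

Consequently (`exists_log_hcProb_tilted`) there is a function `h` holomorphic on the disc
`‖s‖ < 1/4`, bounded by `2n` there, which for real `s` equals `log ℙ_{ν_s^{⊗ι}}(no overlap)`, the
logarithm of the hard-core probability of the TILTED gas `ν_s = (e^{sG}/m(s)) ν` — the polymer
representation (`hcProb_eq_polymerPartitionFunction`), the real-parameter identification
(`tiltedActivity_ofReal`) and the Kotecký–Preiss logarithm
(`exists_differentiableOn_log_polymerPartitionFunction`). This is the analytic input for Cauchy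
bounds on the cumulants of `∑ᵢ G(xᵢ)` under the canonical hard-core Gibbs measure, uniform in `n`.
Folklore; no definitions, no named facts.
-/

noncomputable section

namespace Summit.AtomisticToContinuum.HydrodynamicLimit.Theorems

open Finset MeasureTheory Complex Metric Literature.Probability.LatticeModels
  Literature.MathematicalPhysics.StatisticalMechanics Literature.MathematicalPhysics.KineticTheory

/-! ### Finite sums: unions and the cardinality form of sums over sets through a label -/

/-- **Cardinality form of a sum over the sets through a label**: for a function of the
cardinality, `∑_{γ ∋ i} F(|γ|) = ∑_{j ≤ m} C(m, j) F(j+1)`, `m = |ι| - 1`. [folklore] -/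
theorem sum_filter_mem_apply_card {ι : Type*} [Fintype ι] [DecidableEq ι] (i : ι) (F : ℕ → ℝ) :
    ∑ γ ∈ (univ : Finset ι).powerset.filter (fun γ => i ∈ γ), F γ.card =
      ∑ j ∈ range ((univ.erase i).card + 1), (((univ.erase i).card.choose j : ℕ) : ℝ) * F (j + 1) := by
  rw [sum_filter_mem_eq_sum_powerset_erase univ (mem_univ i) (fun γ => F γ.card)]
  have h1 : ∀ V ∈ (univ.erase i).powerset, F (insert i V).card = F (V.card + 1) := by
    intro V hV
    have hiV : i ∉ V := fun h => (Finset.mem_erase.1 (Finset.mem_powerset.1 hV h)).1 rfl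
    rw [Finset.card_insert_of_notMem hiV]
  rw [Finset.sum_congr rfl h1, Finset.sum_powerset_apply_card (fun j => F (j + 1))]
  refine Finset.sum_congr rfl fun j _ => ?_
  rw [nsmul_eq_mul]

/-- Termwise bound: `C(m, j) (Ae)^{j+1} t(j+1) pʲ ≤ A e² (A e² m p)ʲ` (`C(m,j) ≤ mʲ/j!` and the
tree-number bound `t(j+1) yʲ/j! ≤ e (e y)ʲ`). [folklore] -/
theorem choose_mul_treeNumber_term_le {A p : ℝ} (hA : 0 ≤ A) (hp : 0 ≤ p) (m j : ℕ) :
    (m.choose j : ℝ) * ((A * Real.exp 1) ^ (j + 1) * treeNumber (j + 1) * p ^ j) ≤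
      A * Real.exp 1 ^ 2 * (A * Real.exp 1 ^ 2 * m * p) ^ j := by
  have he := Real.exp_pos 1
  have hy : 0 ≤ (m : ℝ) * (A * Real.exp 1 * p) := by positivity
  have h1 : (m.choose j : ℝ) ≤ (m : ℝ) ^ j / j.factorial := by
    have := Nat.choose_le_pow_div (α := ℝ) j m
    simpa using this
  have h2 := treeNumber_succ_mul_pow_div_factorial_le hy j
  have hfac : (0 : ℝ) < j.factorial := by positivity
  calc (m.choose j : ℝ) * ((A * Real.exp 1) ^ (j + 1) * treeNumber (j + 1) * p ^ j)
      ≤ ((m : ℝ) ^ j / j.factorial) * ((A * Real.exp 1) ^ (j + 1) * treeNumber (j + 1) * p ^ j) :=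
        mul_le_mul_of_nonneg_right h1 (by positivity)
    _ = (A * Real.exp 1) * ((treeNumber (j + 1) : ℝ) * ((m : ℝ) * (A * Real.exp 1 * p)) ^ j / j.factorial) := by
        rw [pow_succ, mul_pow, mul_pow]
        field_simp
        ring
    _ ≤ (A * Real.exp 1) * (Real.exp 1 * (Real.exp 1 * ((m : ℝ) * (A * Real.exp 1 * p))) ^ j) :=
        mul_le_mul_of_nonneg_left h2 (by positivity)
    _ = A * Real.exp 1 ^ 2 * (A * Real.exp 1 ^ 2 * m * p) ^ j := by ring

variable {ι : Type*} [Fintype ι] [DecidableEq ι] {X : Type*} [MeasurableSpace X]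
  {O : X → X → Prop} (ν : Measure X) [IsProbabilityMeasure ν] {G : X → ℝ}

/-! ### The Kotecký–Preiss condition for the tilted activities -/

/-- **The polymers through a label are light**: for `‖s‖ ≤ 1/4`,
`∑_{B ∋ i, |B| ≥ 2} ‖ζ_s(B)‖ e^{|B|} ≤ 2A²e⁴ · n p` with `A = 2e^{1/4}`, `n = |ι|`, provided
`2A²e⁴ n p ≤ 1`. [folklore] -/
theorem sum_kpTerm_filter_mem_le (hO : MeasurableSet {p : X × X | O p.1 p.2})
    (hOs : ∀ a b, O a b → O b a) (hGm : Measurable G) (hG : ∀ y, |G y| ≤ 1) {p : ℝ} (hp0 : 0 ≤ p)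
    (hp : ∀ z, ν {y | O z y} ≤ ENNReal.ofReal p)
    (hsmall : 2 * (2 * Real.exp (1 / 4)) ^ 2 * Real.exp 1 ^ 4 * (Fintype.card ι * p) ≤ 1)
    {s : ℂ} (hs : ‖s‖ ≤ 1 / 4) (i : ι) :
    ∑ γ ∈ ((univ : Finset ι).powerset.filter fun B => 2 ≤ B.card).filter (fun γ => i ∈ γ),
        kpTerm (fun B : Finset ι => (∫ x, (uR O x B : ℂ) * Complex.exp (s * ((∑ i ∈ B, G (x i) : ℝ) : ℂ))
          ∂Measure.pi (fun _ : ι => ν)) / (∫ y, Complex.exp (s * (G y : ℂ)) ∂ν) ^ B.card)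
          (fun B => (B.card : ℝ)) γ ≤
      2 * (2 * Real.exp (1 / 4)) ^ 2 * Real.exp 1 ^ 4 * (Fintype.card ι * p) := by
  set A : ℝ := 2 * Real.exp (1 / 4) with hA
  have hA0 : 0 ≤ A := by positivity
  have hA2 : 2 ≤ A := by
    have : 1 ≤ Real.exp (1 / 4) := Real.one_le_exp (by norm_num)
    rw [hA]; linarith
  have he1 : 1 ≤ Real.exp 1 := Real.one_le_exp (by norm_num)
  set n : ℕ := Fintype.card ι with hn
  set m : ℕ := (univ.erase i).card with hm
  have hmn : (m : ℝ) ≤ n := by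
    rw [hm, hn, Finset.card_erase_of_mem (mem_univ i), Finset.card_univ]
    exact_mod_cast Nat.sub_le _ _
  -- the majorant as a function of the cardinality
  set F : ℕ → ℝ := fun k => if 2 ≤ k then (A * Real.exp 1) ^ k * treeNumber k * p ^ (k - 1) else 0 with hF
  have hF0 : ∀ k, 0 ≤ F k := fun k => by
    simp only [hF]; split_ifs <;> positivity
  -- Step 1: termwise bound by the majorant
  have hterm : ∀ γ ∈ ((univ : Finset ι).powerset.filter fun B => 2 ≤ B.card).filter (fun γ => i ∈ γ),
      kpTerm (fun B : Finset ι => (∫ x, (uR O x B : ℂ) * Complex.exp (s * ((∑ i ∈ B, G (x i) : ℝ) : ℂ))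
          ∂Measure.pi (fun _ : ι => ν)) / (∫ y, Complex.exp (s * (G y : ℂ)) ∂ν) ^ B.card)
          (fun B => (B.card : ℝ)) γ ≤ F γ.card := by
    intro γ hγ
    have h2 : 2 ≤ γ.card := (Finset.mem_filter.1 (Finset.mem_filter.1 hγ).1).2
    have hne : γ.Nonempty := Finset.card_pos.1 (by omega)
    simp only [hF, if_pos h2, kpTerm]
    have hb := norm_tiltedActivity_le ν hO hOs hGm hG hp0 hp hs hne
    calc _ ≤ (2 * Real.exp (1 / 4)) ^ γ.card * (treeNumber γ.card * p ^ (γ.card - 1)) * Real.exp (γ.card : ℝ) :=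
          mul_le_mul_of_nonneg_right hb (Real.exp_nonneg _)
      _ = (A * Real.exp 1) ^ γ.card * treeNumber γ.card * p ^ (γ.card - 1) := by
          rw [← Real.exp_one_pow, mul_pow, hA]; ring
  -- Step 2: enlarge to all sets through `i` and pass to the cardinality form
  have hstep2 : ∑ γ ∈ ((univ : Finset ι).powerset.filter fun B => 2 ≤ B.card).filter (fun γ => i ∈ γ), F γ.card
      ≤ ∑ γ ∈ (univ : Finset ι).powerset.filter (fun γ => i ∈ γ), F γ.card := by
    refine Finset.sum_le_sum_of_subset_of_nonneg (fun γ hγ => ?_) fun γ _ _ => hF0 _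
    have h := Finset.mem_filter.1 hγ
    exact Finset.mem_filter.2 ⟨(Finset.mem_filter.1 h.1).1, h.2⟩
  -- Step 3: the cardinality sum
  set θ : ℝ := A * Real.exp 1 ^ 2 * m * p with hθ
  have hθ0 : 0 ≤ θ := by positivity
  have hθhalf : θ ≤ 1 / 2 := by
    have h1 : θ ≤ A * Real.exp 1 ^ 2 * (n * p) := by
      rw [hθ, mul_assoc (A * Real.exp 1 ^ 2)]
      exact mul_le_mul_of_nonneg_left (mul_le_mul_of_nonneg_right hmn hp0) (by positivity)
    have hAe : 1 ≤ A * Real.exp 1 ^ 2 := by nlinarith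
    have h3 : A * Real.exp 1 ^ 2 * (n * p) * (2 * (A * Real.exp 1 ^ 2)) ≤ 1 := by
      calc _ = 2 * A ^ 2 * Real.exp 1 ^ 4 * (n * p) := by ring
        _ ≤ 1 := by rw [hA]; exact hsmall
    have hnp : 0 ≤ (n : ℝ) * p := by positivity
    nlinarith
  have hcard : ∑ γ ∈ (univ : Finset ι).powerset.filter (fun γ => i ∈ γ), F γ.card ≤
      A * Real.exp 1 ^ 2 * ∑ j ∈ range m, θ ^ (j + 1) := by
    rw [sum_filter_mem_apply_card i F, ← hm, Finset.sum_range_succ']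
    have hzero : ((m.choose 0 : ℕ) : ℝ) * F (0 + 1) = 0 := by simp [hF]
    rw [hzero, add_zero, Finset.mul_sum]
    refine Finset.sum_le_sum fun j _ => ?_
    have hj2 : 2 ≤ j + 1 + 1 := by omega
    simp only [hF, if_pos hj2, Nat.add_sub_cancel]
    exact choose_mul_treeNumber_term_le hA0 hp0 m (j + 1)
  have hgeom : ∑ j ∈ range m, θ ^ (j + 1) ≤ 2 * θ := by
    have h := geom_sum_Ico_le_of_lt_one (m := 0) (n := m) hθ0 (by linarith)
    rw [pow_zero, ← Finset.range_eq_Ico] at h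
    have h2 : ∑ j ∈ range m, θ ^ (j + 1) = θ * ∑ j ∈ range m, θ ^ j := by
      rw [Finset.mul_sum]
      exact Finset.sum_congr rfl fun j _ => by ring
    rw [h2]
    have h3 : 1 / (1 - θ) ≤ 2 := by
      rw [div_le_iff₀ (by linarith)]; linarith
    calc θ * ∑ j ∈ range m, θ ^ j ≤ θ * (1 / (1 - θ)) := mul_le_mul_of_nonneg_left h hθ0
      _ ≤ θ * 2 := mul_le_mul_of_nonneg_left h3 hθ0
      _ = 2 * θ := mul_comm _ _
  calc _ ≤ ∑ γ ∈ ((univ : Finset ι).powerset.filter fun B => 2 ≤ B.card).filter (fun γ => i ∈ γ), F γ.card :=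
        Finset.sum_le_sum hterm
    _ ≤ ∑ γ ∈ (univ : Finset ι).powerset.filter (fun γ => i ∈ γ), F γ.card := hstep2
    _ ≤ A * Real.exp 1 ^ 2 * ∑ j ∈ range m, θ ^ (j + 1) := hcard
    _ ≤ A * Real.exp 1 ^ 2 * (2 * θ) := mul_le_mul_of_nonneg_left hgeom (by positivity)
    _ = 2 * A ^ 2 * Real.exp 1 ^ 4 * (m * p) := by rw [hθ]; ring
    _ ≤ 2 * A ^ 2 * Real.exp 1 ^ 4 * (n * p) :=
        mul_le_mul_of_nonneg_left (mul_le_mul_of_nonneg_right hmn hp0) (by positivity)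
    _ = 2 * (2 * Real.exp (1 / 4)) ^ 2 * Real.exp 1 ^ 4 * (Fintype.card ι * p) := by rw [hA]

/-- **The tilted polymer gas is a Kotecký–Preiss volume** with size function `a(B) = |B|`, for
every tilt `‖s‖ ≤ 1/4`, once `2A²e⁴ n p ≤ 1`: the polymers incompatible with `γ` all pass through
a label of `γ`, and those through one label weigh at most `1`. [folklore] -/
theorem isKPVolume_tilted (hO : MeasurableSet {p : X × X | O p.1 p.2})
    (hOs : ∀ a b, O a b → O b a) (hGm : Measurable G) (hG : ∀ y, |G y| ≤ 1) {p : ℝ} (hp0 : 0 ≤ p)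
    (hp : ∀ z, ν {y | O z y} ≤ ENNReal.ofReal p)
    (hsmall : 2 * (2 * Real.exp (1 / 4)) ^ 2 * Real.exp 1 ^ 4 * (Fintype.card ι * p) ≤ 1)
    {s : ℂ} (hs : ‖s‖ ≤ 1 / 4) :
    IsKPVolume polyInc
      (fun B : Finset ι => (∫ x, (uR O x B : ℂ) * Complex.exp (s * ((∑ i ∈ B, G (x i) : ℝ) : ℂ))
        ∂Measure.pi (fun _ : ι => ν)) / (∫ y, Complex.exp (s * (G y : ℂ)) ∂ν) ^ B.card)
      (fun B => (B.card : ℝ)) ((univ : Finset ι).powerset.filter fun B => 2 ≤ B.card) := by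
  intro γ hγ
  set Λ := (univ : Finset ι).powerset.filter fun B => 2 ≤ B.card with hΛ
  have hγ2 : 2 ≤ γ.card := (Finset.mem_filter.1 hγ).2
  -- incompatible polymers pass through a label of `γ`
  have hsub : Λ.filter (fun γ' => polyInc γ' γ) ⊆ γ.biUnion fun i => Λ.filter fun γ' => i ∈ γ' := by
    intro γ' hγ'
    obtain ⟨hγ'Λ, hinc⟩ := Finset.mem_filter.1 hγ'
    rw [Finset.mem_biUnion]
    rcases hinc with h | ⟨i, hi⟩
    · subst h
      obtain ⟨i, hi⟩ : γ'.Nonempty := Finset.card_pos.1 (by omega)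
      exact ⟨i, hi, Finset.mem_filter.2 ⟨hγ'Λ, hi⟩⟩
    · exact ⟨i, (Finset.mem_inter.1 hi).2, Finset.mem_filter.2 ⟨hγ'Λ, (Finset.mem_inter.1 hi).1⟩⟩
  calc _ ≤ ∑ γ' ∈ γ.biUnion (fun i => Λ.filter fun γ' => i ∈ γ'), _ :=
        Finset.sum_le_sum_of_subset_of_nonneg hsub fun γ' _ _ => kpTerm_nonneg _ _ _
    _ ≤ ∑ i ∈ γ, ∑ γ' ∈ Λ.filter (fun γ' => i ∈ γ'), _ :=
        Literature.Probability.LatticeModels.sum_biUnion_le_sum_of_nonneg _ _ _ fun γ' => kpTerm_nonneg _ _ _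
    _ ≤ ∑ _i ∈ γ, (1 : ℝ) := Finset.sum_le_sum fun i _ =>
        (sum_kpTerm_filter_mem_le ν hO hOs hGm hG hp0 hp hsmall hs i).trans hsmall
    _ = γ.card := by simp

/-! ### The holomorphic logarithm of the tilted hard-core probability -/

/-- **Holomorphic logarithm of the tilted hard-core probability.** Under the smallness condition
`2A²e⁴ n p ≤ 1` there is `h` holomorphic on the disc `‖s‖ < 1/4`, with `‖h s‖ ≤ 2n` there, such that
for every real `s` with `|s| < 1/4`, `h s = log ℙ_{ν_s^{⊗ι}}(no two points overlap)` for the tilted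
probability measure `ν_s = (e^{sG}/m(s)) ν` (polymer representation + Kotecký–Preiss logarithm +
real-parameter identification of the tilted activities). [folklore] -/
theorem exists_log_hcProb_tilted (hO : MeasurableSet {p : X × X | O p.1 p.2})
    (hOs : ∀ a b, O a b → O b a) (hGm : Measurable G) (hG : ∀ y, |G y| ≤ 1) {p : ℝ} (hp0 : 0 ≤ p)
    (hp : ∀ z, ν {y | O z y} ≤ ENNReal.ofReal p)
    (hsmall : 2 * (2 * Real.exp (1 / 4)) ^ 2 * Real.exp 1 ^ 4 * (Fintype.card ι * p) ≤ 1) :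
    ∃ h : ℂ → ℂ, DifferentiableOn ℂ h (ball 0 (1 / 4)) ∧
      (∀ s ∈ ball (0 : ℂ) (1 / 4), ‖h s‖ ≤ 2 * Fintype.card ι) ∧
      ∀ s : ℝ, |s| < 1 / 4 →
        0 < hcProb O (ν.withDensity fun y =>
          ENNReal.ofReal (Real.exp (s * G y) / ∫ y', Real.exp (s * G y') ∂ν)) (univ : Finset ι) ∧
        h s = ((Real.log (hcProb O (ν.withDensity fun y =>
          ENNReal.ofReal (Real.exp (s * G y) / ∫ y', Real.exp (s * G y') ∂ν)) (univ : Finset ι)) : ℝ) : ℂ) := by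
  set Λ := (univ : Finset ι).powerset.filter fun B => 2 ≤ B.card with hΛ
  set w : ℂ → Finset ι → ℂ := fun s B => (∫ x, (uR O x B : ℂ) * Complex.exp (s * ((∑ i ∈ B, G (x i) : ℝ) : ℂ))
    ∂Measure.pi (fun _ : ι => ν)) / (∫ y, Complex.exp (s * (G y : ℂ)) ∂ν) ^ B.card with hw
  have hwd : ∀ γ ∈ Λ, DifferentiableOn ℂ (fun s => w s γ) (ball 0 (1 / 4)) := fun γ _ =>
    differentiableOn_tiltedActivity ν hO hGm hG γ
  have hKP : ∀ s ∈ ball (0 : ℂ) (1 / 4), IsKPVolume polyInc (w s) (fun B => (B.card : ℝ)) Λ := fun s hs =>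
    isKPVolume_tilted ν hO hOs hGm hG hp0 hp hsmall (le_of_lt (by simpa using hs))
  obtain ⟨h, hh, hexp, hnorm, hreal⟩ :=
    exists_differentiableOn_log_polymerPartitionFunction (inc := polyInc) hwd hKP
  refine ⟨h, hh, fun s hs => ?_, fun s hs => ?_⟩
  · -- the bound `‖h s‖ ≤ 2n`
    have hs' : ‖s‖ ≤ 1 / 4 := le_of_lt (by simpa using hs)
    have hcover : Λ ⊆ (univ : Finset ι).biUnion fun i => Λ.filter fun γ => i ∈ γ := by
      intro γ hγ
      have h2 : 2 ≤ γ.card := (Finset.mem_filter.1 hγ).2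
      obtain ⟨i, hi⟩ : γ.Nonempty := Finset.card_pos.1 (by omega)
      exact Finset.mem_biUnion.2 ⟨i, mem_univ i, Finset.mem_filter.2 ⟨hγ, hi⟩⟩
    calc ‖h s‖ ≤ 2 * ∑ γ ∈ Λ, kpTerm (w s) (fun B => (B.card : ℝ)) γ := hnorm s hs
      _ ≤ 2 * ∑ γ ∈ (univ : Finset ι).biUnion (fun i => Λ.filter fun γ => i ∈ γ),
            kpTerm (w s) (fun B => (B.card : ℝ)) γ :=
          mul_le_mul_of_nonneg_left (Finset.sum_le_sum_of_subset_of_nonneg hcover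
            fun γ _ _ => kpTerm_nonneg _ _ _) (by norm_num)
      _ ≤ 2 * ∑ i ∈ (univ : Finset ι), ∑ γ ∈ Λ.filter (fun γ => i ∈ γ), kpTerm (w s) (fun B => (B.card : ℝ)) γ :=
          mul_le_mul_of_nonneg_left (Literature.Probability.LatticeModels.sum_biUnion_le_sum_of_nonneg _ _ _ fun γ => kpTerm_nonneg _ _ _) (by norm_num)
      _ ≤ 2 * ∑ _i ∈ (univ : Finset ι), (1 : ℝ) := by
          refine mul_le_mul_of_nonneg_left (Finset.sum_le_sum fun i _ => ?_) (by norm_num)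
          exact (sum_kpTerm_filter_mem_le ν hO hOs hGm hG hp0 hp hsmall hs' i).trans hsmall
      _ = 2 * Fintype.card ι := by simp
  · -- real parameters: `h s = log Ξ_s`
    have hsC : ((s : ℝ) : ℂ) ∈ ball (0 : ℂ) (1 / 4) := by simpa using hs
    set νs := ν.withDensity fun y => ENNReal.ofReal (Real.exp (s * G y) / ∫ y', Real.exp (s * G y') ∂ν) with hνs
    haveI : IsProbabilityMeasure νs := isProbabilityMeasure_tilted ν hGm hG s
    -- the activities at a real parameter are the tilted Ursell integrals
    have hact : ∀ γ ∈ Λ, w (s : ℂ) γ = ((∫ x, uR O x γ ∂Measure.pi (fun _ : ι => νs) : ℝ) : ℂ) :=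
      fun γ _ => (tiltedActivity_ofReal ν hO hGm hG s γ).symm
    have hZ : polymerPartitionFunction polyInc (w (s : ℂ)) Λ = ((hcProb O νs (univ : Finset ι) : ℝ) : ℂ) := by
      rw [polymerPartitionFunction_congr hact, hcProb_eq_polymerPartitionFunction νs hO univ]
    have him : (h (s : ℂ)).im = 0 := hreal _ hsC fun γ _ => im_tiltedActivity_ofReal ν hO hGm hG s γ
    have hre : (h (s : ℂ)).re = Real.log (hcProb O νs (univ : Finset ι)) :=
      re_eq_log_of_exp_eq_ofReal him (by rw [hexp _ hsC, hZ])
    refine ⟨?_, ?_⟩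
    · refine lt_of_le_of_ne (hcProb_nonneg _ _) fun h0 => ?_
      have h1 := hexp _ hsC
      rw [hZ, ← h0] at h1
      simp at h1
    · rw [← hre]
      exact Complex.ext (by simp) (by simp [him])

end Summit.AtomisticToContinuum.HydrodynamicLimit.Theorems

end
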